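import Summits.HodgeConjecture.CorCM.B01.Transposition.Item6CentralTypeAtPinIndex
import Summits.HodgeConjecture.HodgeCM.Model.LiuDictionaryPinEq
import Literature.NumberTheory.Automorphic.Liu2021.Def411WeilCarriersCentralTypeRigidity
import HarnessLib

/-!
# X3-Char at the COR-CM pin: a CONTINUOUS index line forces `ι₁` to be the CANONICAL embedding of its place

Cell pub-hodgecm2 (COR-CM), seat pin-3 (gen 14), 2026-08-24.  Sequel of `Transposition/Item6CentralTypeAtPinIndex` (port layers L69 ∕ L72).

The package table `LiuIndex.muLiu ι₁ ρ q = ∓𝟙_{w₁}` keys its sign at the place `w₁` of `ι₁` on `ι₁ ∈ Φ^δ(q)`, while the archimedean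
central type of a dictionary splitting `ι_μ` (`μ` weight one, `Φ_μ = Φ^δ(a)`) keys it on `w₁.embedding ∈ Φ^δ(a)`
(`centralType_weightOneType_of_deltaPos`); the two agree iff `(mk ι₁).embedding = ι₁` — the hypothesis `hemb` carried by
`centralType_weightOneType_lineType_eq_muLiu` and by both directions of item (E) at the index.  THIS FILE proves that `hemb` is FORCED by
the existence of ONE continuous index line, for EVERY section `ρ` of `mk` and every typing section `ρ'`:

* `exists_nsmul_eq_muLiu_sub_centralType` — the rigidity of the archimedean type along the central-type fibre
  ([GelbartRogawski1991, §3.1 Remark p. 457]: every continuous compatible splitting is `ι_{χ₀} ⊗ (α ∘ det)`, `det (t · 1_V) = t³`) read at an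
  index line `i` with continuous pair splitting against the weight-one base point of `Φ^δ(ρ i.1)`: `3 • k = muLiu ι₁ ρ' i.1 − centralType
  (weightOneType Φ^δ(ρ i.1))` for some `k : InfinitePlace L → ℤ`;
* **`embedding_mk_eq_of_continuous`** — hence `(mk ι₁).embedding = ι₁`: at a non-canonical `ι₁` the right-hand side is `±2` at `w₁`, not a
  multiple of `3`; equivalently `not_continuous_of_embedding_mk_ne`: at a NON-canonical `ι₁` the index `I V ρ (muLiu ι₁ ρ')` has NO continuous
  line (every `block` of the pinned dictionary is then killed by `BlockVanishing.block_pin_line_eq_bot_of_not_continuous`);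
* `exists_weightOne_line_s_eq_chiSplittingLine_toHeckeCharacter_of_continuous` — the `hemb`-FREE form of the Ω-pin key
  `exists_weightOne_line_s_eq_chiSplittingLine_toHeckeCharacter`: every continuous index line is `ι_μ`, `μ` conjugate symplectic of
  weight one with `HasCMType μ (line i).lineType`, with NO hypothesis on `ι₁`; §4 the same at the INDEX OF RECORD
  `I V (repAt a₀) (muLiu ι₁ GramClass.rep)` in the spelling of `OmegaPin.key_indexOfRecord` (`key_indexOfRecord_of_continuous`).

KERNEL only (theorems, no definition, no named fact).  HC_CM is NOT proved here or anywhere; nothing here inhabits `hLiu ∕ hM`; no pointer moves.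
-/

set_option autoImplicit false

noncomputable section

namespace Summit.HodgeConjecture.CorCM.Transposition.CentralTypeAtPin

open NumberField NumberField.InfinitePlace NumberField.mixedEmbedding IsDedekindDomain
open scoped Matrix SchwartzMap Classical TensorProduct
open Literature.NumberTheory.Automorphic Literature.NumberTheory.Automorphic.UnitaryGroup Literature.NumberTheory.Weil1964
open Literature.NumberTheory.GelbartRogawski1991 Literature.NumberTheory.GelbartRogawski1991.UnitaryDualPair
open Literature.NumberTheory.GelbartRogawski1991.GRConstruction
open Literature.NumberTheory.Automorphic.Liu2021.Def411WeilCarriersDoubling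
open Literature.NumberTheory.Automorphic.IdeleClassGroup
open Literature.NumberTheory.GaloisRepresentations
open Literature.RepresentationTheory.HarrisKudlaSweet1996
open HodgeCM HodgeCM.Model HodgeCM.Model.LiuIndex
open HodgeCM.SignRecipe (lineType mem_lineType_iff eta_eq_imagUnit)
open HodgeCM.Model.ArchSideTerm (e₁)

variable {L : CMField} {ι₁ : (L : Type) →+* ℂ} (V : HermSpace3 L ι₁) (ρ ρ' : GramClass L → RealScalar L)

/-! ## §1 The archimedean exponent equation of a continuous index line -/

set_option maxHeartbeats 4000000 in
/-- **`3 • k = muLiu ι₁ ρ' i.1 − centralType (weightOneType Φ^δ(ρ i.1))`** for a continuous index line `i : I V ρ (muLiu ι₁ ρ')`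
(`ρ`, `ρ'` sections of `mk`): the line's pair splitting is `ι_{μ₀} ⊗ (α ∘ det)` for the weight-one base point `μ₀` of `Φ^δ(ρ i.1)`
([WeilBNT VII §3] existence, `IdeleClassGroup.exists_isConjugateSymplectic_hasCMType`) and a continuous unitary automorphic `α` of
`U(1)(𝔸_{L⁺})` of archimedean exponents `k` ([GelbartRogawski1991, §3.1 Remark p. 457 L4–13], rank-3 det-factorisation
`AdelicCharactersDet.centralCharFactorsThroughDet_rank_three`); comparing the two central characters on a non-zero test function of the
Gaussian (`det (t · 1_V) = t³`) gives the exponent equation (`exists_eq_chiSplittingLine_archType_of_center`).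
[cite: GelbartRogawski1991, §3.1 Remark p. 457 L4–13] [cite: Liu2021, App. D §D.1 Step 2 (l. 5219)] -/
theorem exists_nsmul_eq_muLiu_sub_centralType (hρ : ∀ q, GramClass.mk (ρ q) = q) (i : I V ρ (muLiu ι₁ ρ'))
    (hsc : Continuous (i.2.1 : SplittingAt V (ρ i.1))) :
    ∃ k : InfinitePlace (L : Type) → ℤ,
      3 • k = muLiu ι₁ ρ' i.1 -
        centralType (L : Type) e₁ (frameD V) (frameD_real V) (RealScalar.vec (ρ i.1)) (RealScalar.vec_real (ρ i.1))
          (weightOneType (L : Type) (lineType (ρ i.1).1 (ρ i.1).2.1 (ρ i.1).2.2)) := by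
  obtain ⟨μ₀, hμ₀, hw, hΦμ⟩ := exists_isConjugateSymplectic_hasCMType (L := (L : Type)) (lineType (ρ i.1).1 (ρ i.1).2.1 (ρ i.1).2.2)
  obtain ⟨x₀, hx₀⟩ := exists_testFun_gaussianAt_ne_zero V (ρ i.1)
  have h₀ := hasCentralTypeAt_chiSplittingLine_toHeckeCharacter_weightOneType V (ρ i.1) μ₀ hμ₀ hw hΦμ
  have h := hasCentralTypeAt_of_mem' V hρ (muLiu ι₁ ρ') i
  obtain ⟨α, hα, hαrat, hαu, k, -, -, hk⟩ :=
    exists_eq_chiSplittingLine_archType_of_center (L : Type) e₁ (frameD V) (frameD_real V) (frameD_ne V)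
      (realDiagonal (L : Type) (RealScalar.vec (ρ i.1)) (RealScalar.vec_real (ρ i.1)))
      (realDiagonal_isSymm (L : Type) (RealScalar.vec (ρ i.1)) (RealScalar.vec_real (ρ i.1)))
      (isUnit_det_realDiagonal (L : Type) (RealScalar.vec (ρ i.1)) (RealScalar.vec_real (ρ i.1)) (RealScalar.vec_ne (ρ i.1)))
      (Matrix.diagonal (RealScalar.vec (ρ i.1))) (realDiagonal_map (L : Type) (RealScalar.vec (ρ i.1)) (RealScalar.vec_real (ρ i.1))).symm
      (AdelicCharactersDet.centralCharFactorsThroughDet_rank_three (L : Type) e₁ (frameD V) (frameD_real V) (frameD_ne V)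
        (Matrix.diagonal (RealScalar.vec (ρ i.1))) (by simpa using RealScalar.vec_real (ρ i.1) 0)
        (by simpa using RealScalar.vec_ne (ρ i.1) 0) _)
      (toHeckeCharacter (L : Type) μ₀) (isUnitary_toHeckeCharacter (L : Type) μ₀)
      (isSplittingChar_toHeckeCharacter_of_isConjugateSymplectic (L : Type) μ₀ hμ₀) hsc (isCompatAt_of_mem V ρ _ i) hx₀
      (fun t => h₀ t x₀ 1) (fun t => h t x₀ 1)
  exact ⟨k, hk⟩

/-! ## §2 A continuous index line forces the canonical embedding -/

set_option maxHeartbeats 4000000 in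
/-- **A CONTINUOUS INDEX LINE FORCES `(mk ι₁).embedding = ι₁`.**  For sections `ρ`, `ρ'` of `mk` and an index `i : I V ρ (muLiu ι₁ ρ')`
with continuous pair splitting, `ι₁` is the distinguished embedding of its place: otherwise `(mk ι₁).embedding = ῑ₁`, the table
`muLiu ι₁ ρ' i.1 = ∓𝟙_{w₁}` (sign: `ι₁ ∈ Φ^δ`) and the central type `centralType (weightOneType Φ^δ) = ∓𝟙_{w₁}` (sign: `ῑ₁ ∈ Φ^δ`,
`centralType_weightOneType_of_deltaPos`) are NEGATIVES of each other (`Φ^δ` contains exactly one of `ι₁, ῑ₁`), so the exponent equation of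
§1 reads `3 k_{w₁} = ±2` — impossible.  Hence the `hemb` hypothesis of item (E) at the index is a CONSEQUENCE of continuity.
[cite: GelbartRogawski1991, §3.1 Remark p. 457 L4–13] [cite: KonnoKonno2007, Lemma 5.2 p. 73] [cite: Liu2021, Def. 4.12, App. D Lem. D.2] -/
theorem embedding_mk_eq_of_continuous (hρ : ∀ q, GramClass.mk (ρ q) = q) (hρ' : ∀ q, GramClass.mk (ρ' q) = q)
    (i : I V ρ (muLiu ι₁ ρ')) (hsc : Continuous (i.2.1 : SplittingAt V (ρ i.1))) :
    (InfinitePlace.mk ι₁).embedding = ι₁ := by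
  obtain ⟨k, hk⟩ := exists_nsmul_eq_muLiu_sub_centralType V ρ ρ' hρ i hsc
  set Φ := lineType (ρ i.1).1 (ρ i.1).2.1 (ρ i.1).2.2 with hΦdef
  have hΦ : ∀ φ : (L : Type) →+* ℂ, φ ∈ Φ.1 ↔ 0 < (φ (imagUnit (L : Type) * (ρ i.1).1)).im := fun φ => by
    rw [hΦdef, mem_lineType_iff, eta_eq_imagUnit]
  have hw₁ : (cmPlaceOver (L : Type) (HypCensus.cmPlace (L : Type) ι₁)).1 = InfinitePlace.mk ι₁ :=
    cmPlaceOver_eq_mk (L : Type) _ ι₁ rfl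
  -- the exponent equation at the place `w₁ = mk ι₁`
  have hk₁ := congr_fun hk (InfinitePlace.mk ι₁)
  simp only [Pi.smul_apply, Pi.sub_apply, nsmul_eq_mul, Nat.cast_ofNat] at hk₁
  -- the table at `w₁`: `∓1` as `ι₁ ∈ Φ^δ`
  have hm : muLiu ι₁ ρ' i.1 (InfinitePlace.mk ι₁) = if ι₁ ∈ Φ.1 then -1 else 1 := by
    have e1 : muLiu ι₁ ρ' i.1 = muLiu ι₁ ρ' (GramClass.mk (ρ i.1)) := by rw [hρ i.1]
    rw [e1, muLiu_mk hρ' (ρ i.1)]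
    unfold placeIndicator
    rw [hw₁]
    split_ifs <;> simp
  -- the central type at `w₁`: `∓1` as `w₁.embedding ∈ Φ^δ`
  have hc : centralType (L : Type) e₁ (frameD V) (frameD_real V) (RealScalar.vec (ρ i.1)) (RealScalar.vec_real (ρ i.1))
      (weightOneType (L : Type) Φ) (InfinitePlace.mk ι₁) = if (InfinitePlace.mk ι₁).embedding ∈ Φ.1 then -1 else 1 := by
    rw [centralType_weightOneType_of_deltaPos V (ρ i.1) Φ hΦ]
    split_ifs <;> simp
  rw [hm, hc] at hk₁
  by_contra hne
  have hconj : (InfinitePlace.mk ι₁).embedding = ComplexEmbedding.conjugate ι₁ := (embedding_mk_eq ι₁).resolve_left hne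
  by_cases hι : ι₁ ∈ Φ.1
  · have hnot : (InfinitePlace.mk ι₁).embedding ∉ Φ.1 := by
      rw [hconj]
      exact (Φ.2 ι₁).1 hι
    rw [if_pos hι, if_neg hnot] at hk₁
    omega
  · have hmem : (InfinitePlace.mk ι₁).embedding ∈ Φ.1 := by
      rw [hconj]
      by_contra h2
      exact hι ((Φ.2 ι₁).2 h2)
    rw [if_neg hι, if_pos hmem] at hk₁
    omega

/-- **At a NON-canonical `ι₁` the pinned index has NO continuous line**: if `(mk ι₁).embedding ≠ ι₁` then every index
`i : I V ρ (muLiu ι₁ ρ')` has discontinuous pair splitting (contrapositive of `embedding_mk_eq_of_continuous`); with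
`BlockVanishing.block_pin_line_eq_bot_of_not_continuous` every block of the pinned dictionary of record then vanishes.
[cite: GelbartRogawski1991, §3.1 Remark p. 457 L4–13] [cite: Liu2021, Def. 4.12] -/
theorem not_continuous_of_embedding_mk_ne (hρ : ∀ q, GramClass.mk (ρ q) = q) (hρ' : ∀ q, GramClass.mk (ρ' q) = q)
    (hne : (InfinitePlace.mk ι₁).embedding ≠ ι₁) (i : I V ρ (muLiu ι₁ ρ')) :
    ¬ Continuous (i.2.1 : SplittingAt V (ρ i.1)) :=
  fun hsc => hne (embedding_mk_eq_of_continuous V ρ ρ' hρ hρ' i hsc)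

/-- the continuous part of the pinned index is EMPTY at a non-canonical `ι₁`. [cite: GelbartRogawski1991, §3.1 Remark p. 457 L4–13] -/
theorem isEmpty_continuous_index_of_embedding_mk_ne (hρ : ∀ q, GramClass.mk (ρ q) = q) (hρ' : ∀ q, GramClass.mk (ρ' q) = q)
    (hne : (InfinitePlace.mk ι₁).embedding ≠ ι₁) :
    IsEmpty {i : I V ρ (muLiu ι₁ ρ') // Continuous (i.2.1 : SplittingAt V (ρ i.1))} :=
  ⟨fun i => not_continuous_of_embedding_mk_ne V ρ ρ' hρ hρ' hne i.1 i.2⟩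

/-! ## §3 The Ω-pin key with NO hypothesis on `ι₁` -/

set_option maxHeartbeats 4000000 in
/-- **EVERY CONTINUOUS INDEX LINE IS `ι_μ`, `μ` CONJUGATE SYMPLECTIC OF WEIGHT ONE WITH `Φ_μ = (line i).lineType` — `hemb`-FREE.**
`exists_weightOne_line_s_eq_chiSplittingLine_toHeckeCharacter` with its hypothesis `(mk ι₁).embedding = ι₁` DISCHARGED by
`embedding_mk_eq_of_continuous` from the continuity of the line itself: the Ω-pin key of the Δ2 bridge
(`OmegaPin.key_indexOfRecord`) needs no identification of `ι₁` with its place's embedding.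
[cite: Liu2021, Def. 4.1 ∕ 4.3, Def. 4.12, Prop. 4.13, App. D §D.1 Step 2 (l. 5219)] [cite: GelbartRogawski1991, §3.1 Remark p. 457 L4–13] -/
theorem exists_weightOne_line_s_eq_chiSplittingLine_toHeckeCharacter_of_continuous (hρ : ∀ q, GramClass.mk (ρ q) = q)
    (hρ' : ∀ q, GramClass.mk (ρ' q) = q) (i : I V ρ (muLiu ι₁ ρ'))
    (hsc : Continuous (i.2.1 : SplittingAt V (ρ i.1))) :
    ∃ (μ : Literature.NumberTheory.Automorphic.IdeleClassGroup (L : Type) →ₜ* Circle) (hμ : IsConjugateSymplectic (L : Type) μ),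
      HasWeight (L : Type) μ 1 ∧ HasCMType (L : Type) μ (line V ρ (muLiu ι₁ ρ') i).lineType ∧
        (line V ρ (muLiu ι₁ ρ') i).s =
          chiSplittingLine (L : Type) e₁ (frameD V) (frameD_real V) (frameD_ne V) (toHeckeCharacter (L : Type) μ)
            (isUnitary_toHeckeCharacter (L : Type) μ) (isSplittingChar_toHeckeCharacter_of_isConjugateSymplectic (L : Type) μ hμ)
            (realDiagonal (L : Type) (RealScalar.vec (ρ i.1)) (RealScalar.vec_real (ρ i.1)))
            (isUnit_det_realDiagonal (L : Type) (RealScalar.vec (ρ i.1)) (RealScalar.vec_real (ρ i.1)) (RealScalar.vec_ne (ρ i.1)))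
            (Matrix.diagonal (RealScalar.vec (ρ i.1)))
            (realDiagonal_map (L : Type) (RealScalar.vec (ρ i.1)) (RealScalar.vec_real (ρ i.1))).symm :=
  exists_weightOne_line_s_eq_chiSplittingLine_toHeckeCharacter V ρ ρ' hρ hρ' (embedding_mk_eq_of_continuous V ρ ρ' hρ hρ' i hsc) i hsc

/-- **the table identity `centralType (weightOneType Φ^δ(ρ q)) = muLiu ι₁ ρ q` holds at every class CARRYING a continuous index line**,
with no hypothesis on `ι₁` (`centralType_weightOneType_lineType_eq_muLiu` ∘ `embedding_mk_eq_of_continuous`). [cite: Liu2021, Def. 4.12, App. D Lem. D.2] -/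
theorem centralType_weightOneType_lineType_eq_muLiu_of_continuous (hρ : ∀ q, GramClass.mk (ρ q) = q)
    (hρ' : ∀ q, GramClass.mk (ρ' q) = q) (i : I V ρ (muLiu ι₁ ρ')) (hsc : Continuous (i.2.1 : SplittingAt V (ρ i.1)))
    (q : GramClass L) :
    centralType (L : Type) e₁ (frameD V) (frameD_real V) (RealScalar.vec (ρ q)) (RealScalar.vec_real (ρ q))
        (weightOneType (L : Type) (lineType (GramClass.scalar ρ q) (GramClass.conj_scalar ρ q) (GramClass.scalar_ne ρ q))) =
      muLiu ι₁ ρ q :=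
  centralType_weightOneType_lineType_eq_muLiu V ρ (embedding_mk_eq_of_continuous V ρ ρ' hρ hρ' i hsc) q

/-! ## §4 At the index of record `I V (repAt a₀) (muLiu ι₁ GramClass.rep)` (the `h418` binder's enumeration) -/

/-- at the index of record, a continuous index line forces the canonical embedding (`embedding_mk_eq_of_continuous` at the sections
`repAt a₀` ∕ `GramClass.rep` of `mk`). [cite: GelbartRogawski1991, §3.1 Remark p. 457 L4–13] [cite: Liu2021, Def. 4.12] -/
theorem embedding_mk_eq_of_continuous_indexOfRecord (a₀ : RealScalar L) (i : I V (repAt a₀) (muLiu ι₁ GramClass.rep))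
    (hg : Continuous (i.2.1 : SplittingAt V (repAt a₀ i.1))) : (InfinitePlace.mk ι₁).embedding = ι₁ :=
  embedding_mk_eq_of_continuous V (repAt a₀) GramClass.rep (fun q => repAt_spec a₀ q) GramClass.mk_rep i hg

set_option maxHeartbeats 4000000 in
/-- **THE Ω-PIN KEY OF RECORD WITH NO HYPOTHESIS ON `ι₁`**: the statement of `OmegaPin.key_indexOfRecord` (✔ `D2Bridge/OmegaPinAtLiuIndexOfRecord`;
the third argument of `chiSplittingLine` is a proof, so the spelling through `isSplittingChar_toHeckeCharacter_of_isConjugateSymplectic` is the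
same type), its `hemb` DISCHARGED by `embedding_mk_eq_of_continuous_indexOfRecord` — pluggable as the `key` of `OmegaPin.exists_pinTerms_update`.
[cite: Liu2021, Def. 4.1 ∕ 4.3, Def. 4.12 (FJcycle.tex l. 2102–2108), Prop. 4.13 (l. 2113–2119), App. D §D.1 Step 2 (l. 5219)] -/
theorem key_indexOfRecord_of_continuous (a₀ : RealScalar L) (i : I V (repAt a₀) (muLiu ι₁ GramClass.rep))
    (_hi : SplitLine.PhiMuLine ι₁ (line V (repAt a₀) (muLiu ι₁ GramClass.rep) i))
    (hg : Continuous (i.2.1 : SplittingAt V (repAt a₀ i.1))) :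
    ∃ (μ : Literature.NumberTheory.Automorphic.IdeleClassGroup (L : Type) →ₜ* Circle) (hμ : IsConjugateSymplectic (L : Type) μ),
      HasWeight (L : Type) μ 1 ∧ HasCMType (L : Type) μ (line V (repAt a₀) (muLiu ι₁ GramClass.rep) i).lineType ∧
        (line V (repAt a₀) (muLiu ι₁ GramClass.rep) i).s =
          chiSplittingLine (L : Type) e₁ (frameD V) (frameD_real V) (frameD_ne V) (toHeckeCharacter (L : Type) μ)
            (isUnitary_toHeckeCharacter (L : Type) μ) (isSplittingChar_toHeckeCharacter_of_isConjugateSymplectic (L : Type) μ hμ)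
            (realDiagonal (L : Type) (RealScalar.vec (repAt a₀ i.1)) (RealScalar.vec_real (repAt a₀ i.1)))
            (isUnit_det_realDiagonal (L : Type) (RealScalar.vec (repAt a₀ i.1)) (RealScalar.vec_real (repAt a₀ i.1))
              (RealScalar.vec_ne (repAt a₀ i.1)))
            (Matrix.diagonal (RealScalar.vec (repAt a₀ i.1)))
            (realDiagonal_map (L : Type) (RealScalar.vec (repAt a₀ i.1)) (RealScalar.vec_real (repAt a₀ i.1))).symm :=
  exists_weightOne_line_s_eq_chiSplittingLine_toHeckeCharacter V (repAt a₀) GramClass.rep (fun q => repAt_spec a₀ q)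
    GramClass.mk_rep (embedding_mk_eq_of_continuous_indexOfRecord V a₀ i hg) i hg

end Summit.HodgeConjecture.CorCM.Transposition.CentralTypeAtPin

end
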